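import Summits.Ventures.PercRepro.C026UpTo5
import Summits.Ventures.PercRepro.C026SeriesParallel

/-!
# C-026 at every edge weight on THE NET — the smallest marked graph outside every landed family (p6, gen 12)

The **net** is the triangle `3 4 5` with the three marks pendant at its corners: `0–3`, `1–4`, `2–5`
(six edges, six free weights).  It is the smallest marked graph that no landed family covers: not
acyclic (the triangle), not hub-pair, not a star gadget, and not series–parallel reducible at the
non-marks (every non-mark has degree three), and it is the core of every marked multigraph with at
most one cycle whose three marks sit in different branches (`proofs/P6-unicyclic.md`, Theorem U).

C-026 holds on it at EVERY `p ∈ [0,1]^6` by the antipodal principle (`quadForm_nonneg_of_minors`):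

* the faces `[⊥, u]` (the `2^6` spanning subgraphs, `3^6 = 729` antipodal pairs in all) are decided
  by the kernel through p5's `Check26` (`check26_net`), read back as the integer face slacks
  (`faceSlack26Z_eq_sum_face`, `faceSumQuad_kernel26_eq_faceSlack26Z`);
* every class with a sure edge contracts the net to at most five vertices
  (`card_quotient_le_of_open_edge`), where p5's kernel census `classPositive26_5` applies.

`c026_net` is the `C026At` statement of the reduction calculus, so every instance that
series–parallel–pendant reduces to the net inherits C-026 (`C026At_of_reduces'`).
-/

namespace PercRepro

open Finset

namespace MultiGraph

variable {V E : Type*} (G : MultiGraph V E) [DecidableEq V] [Fintype V] [Fintype E] [DecidableEq E]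

/-- The integer face slack `[⊥, u]` of C-026 as a sum over the face cube (the form of
`faceSum`): the points of `[⊥, u]` are the embedded face configurations. -/
theorem faceSlack26Z_eq_sum_face (a b c : V) (u : Config E) :
    G.faceSlack26Z a b c u = ∑ ρ : Config (Face u ⊥),
      kernel26Z (G.row3D a b c (embed u ⊥ ρ)) (G.row3D a b c (embed u ⊥ ρᶜ)) := by
  unfold faceSlack26Z
  symm
  refine Finset.sum_bij' (fun ρ _ => embed u ⊥ ρ) (fun ω _ => restrict u ⊥ ω) ?_ ?_ ?_ ?_ ?_
  · intro ρ _
    exact Finset.mem_filter.mpr ⟨Finset.mem_univ _, embed_le' bot_le ρ⟩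
  · intro ω _
    exact Finset.mem_univ _
  · intro ρ _
    exact restrict_embed u ⊥ ρ
  · intro ω hω
    exact embed_restrict_of_le bot_le (Finset.mem_filter.mp hω).2
  · intro ρ _
    rw [antipode_embed]

/-- **The C-026 class sum of a face `[⊥, u]` is its integer face slack.** -/
theorem faceSumQuad_kernel26_eq_faceSlack26Z (a b c : V) (u : Config E) :
    G.faceSumQuad ![a, b, c] kernel26 u ⊥ = (G.faceSlack26Z a b c u : ℝ) := by
  rw [G.faceSlack26Z_eq_sum_face]
  unfold faceSumQuad faceSum
  push_cast
  exact Finset.sum_congr rfl fun ρ _ => G.kernel26_eq a b c _ _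

omit [DecidableEq V] [Fintype E] [DecidableEq E] in
open Classical in
/-- **A sure non-loop edge contracts**: the sure clusters of `(·, v)` number fewer than the vertices
as soon as `v` opens an edge with two distinct endpoints. -/
theorem card_quotient_lt_of_open_edge {v : Config E} {e : E} (he : v e = true)
    (hne : G.fst e ≠ G.snd e) :
    Fintype.card (Quotient (G.connSetoid v)) < Fintype.card V := by
  refine Fintype.card_lt_of_surjective_not_injective (Quotient.mk (G.connSetoid v))
    Quotient.mk_surjective fun hinj => hne (hinj ?_)
  exact (G.sureClass_eq_iff v _ _).mpr (Conn.of_openAdj (G.openAdj_of_open e he))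

end MultiGraph

namespace Examples

open MultiGraph

/-- **The net**: the triangle `3 4 5` with the marks `0, 1, 2` pendant at its corners
(`0–3`, `1–4`, `2–5`); edges `0, 1, 2` are the pendants, `3, 4, 5` the triangle. -/
def net : MultiGraph (Fin 6) (Fin 6) where
  fst := ![0, 1, 2, 3, 4, 5]
  snd := ![3, 4, 5, 4, 5, 3]

/-- The net has no loops. -/
theorem net_fst_ne_snd (e : Fin 6) : net.fst e ≠ net.snd e := by
  revert e
  decide

/-- **The kernel decides the faces of the net**: every spanning subgraph has a nonnegative C-026
class sum (`3^6 = 729` antipodal pairs). -/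
theorem check26_net : net.Check26 0 1 2 = true := by
  decide +kernel

/-- Every face `[⊥, u]` of the net has nonnegative C-026 class sum. -/
theorem net_faceSumQuad_nonneg (u : Config (Fin 6)) :
    0 ≤ net.faceSumQuad ![0, 1, 2] kernel26 u ⊥ := by
  rw [net.faceSumQuad_kernel26_eq_faceSlack26Z]
  exact_mod_cast net.faceSlack26Z_nonneg_of_check 0 1 2 check26_net u

open Classical in
/-- Every class `(u, v)` of the net with a sure edge lives on at most five sure clusters. -/
theorem net_card_quotient_le {v : Config (Fin 6)} (hv : v ≠ ⊥) :
    Fintype.card (Quotient (net.connSetoid v)) ≤ 5 := by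
  obtain ⟨e, he⟩ : ∃ e, v e = true := by
    by_contra h
    refine hv (funext fun e => ?_)
    have : v e ≠ true := fun he => h ⟨e, he⟩
    simpa using this
  have := net.card_quotient_lt_of_open_edge he (net_fst_ne_snd e)
  simp only [Fintype.card_fin] at this
  omega

/-- **Every marked minor of the net has a nonnegative C-026 class sum**: the faces `[⊥, u]` by the
kernel check, the contractions by p5's five-vertex census. -/
theorem net_minor_cubeSumQuad_nonneg (u v : Config (Fin 6)) (_hvu : v ≤ u) :
    0 ≤ (net.minor u v).cubeSumQuad (fun i => net.sureClass v (![0, 1, 2] i)) kernel26 := by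
  classical
  by_cases hv : v = ⊥
  · subst hv
    rw [← net.faceSumQuad_eq_minor]
    exact net_faceSumQuad_nonneg u
  · exact ClassPositiveUpTo_of_simple (ClassPositiveSimpleUpTo_kernel26_of_inj classPositive26_5)
      (net_card_quotient_le hv) (net.minor u v) _

/-- **C-026 on the net at every edge weight**: the quadratic form of `kernel26` is nonnegative
because every marked minor has nonnegative class sum. -/
theorem c026_net (p : Fin 6 → ℝ) (hp : IsProb p) : net.C026At p 0 1 2 := by
  unfold C026At
  have h := net.quadForm_nonneg_of_minors hp ![0, 1, 2] kernel26 net_minor_cubeSumQuad_nonneg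
  rw [net.quadForm_kernel26] at h
  linarith

end Examples

end PercRepro
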